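import Mathlib
import HarnessLib

/-!
# `DensityLadder.SeparatedTowerDensityLine` (item stmt-RiemannHypothesis-24918) — stub S2:
# exponent extraction

LINE L57 «sieve sight above the density line» (rh-idea-10 g1), BC3 skeleton `Birth.lean`
(evidence on stmt-RiemannHypothesis-24918): the crux `SeparatedTowerDensityLine` is the composition
of S1 `stub_separatedMeanValueCount` (the separated mean-value count bound, analytic, open) and S2
`stub_exponentExtraction` (real analysis).  This file proves S2 with its registered signature:
if the off-line family is discrete below `β` (finitely many abscissae in `(1/2, β']` for every
`β' < β`), has the upper counts `#{σ₀ ≤ Re ρ, |Im ρ| ≤ T} ≤ C T^{2(1−σ₀)} log² T` for every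
`σ₀ ∈ (1/2, β)`, and the lower count `c T^e ≤ #{1/2 < Re ρ, |Im ρ| ≤ T}`, then `e ≤ 2(1 − β)`:
for `σ₀ < β` close to `β`, `{1/2 < Re ρ, |Im ρ| ≤ T} ⊆ {σ₀ ≤ Re ρ, |Im ρ| ≤ T} ∪ {1/2 < Re ρ ≤ σ₀}`,
so `c T^e ≤ C T^{2(1−σ₀)} log² T + O(1)`, impossible for large `T` if `e > 2(1 − σ₀)`.
Cell rh-split, seat rh-split-prover-l57 g0.  RH-free, ζ-free; FRONTIER bookkeeping; nothing here
bears on the truth of RH.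
-/

set_option linter.dupNamespace false

noncomputable section

open Filter Set Topology

namespace Summit.RiemannHypothesis.RiemannHypothesis.Theorems.DensityLadderSeparatedTowerExponent

/-- **Exponent extraction (stub S2 of the `SeparatedTowerDensityLine` skeleton, registered
signature)**: discreteness below `β` + upper counts `≪ T^{2(1−σ₀)} log² T` right of every
`σ₀ ∈ (1/2, β)` + a lower count `c T^e` force `e ≤ 2(1 − β)`. [folklore] -/
theorem separatedTower_exponentExtraction :
    ∀ (ι : Type) (ρ : ι → ℂ) (β e : ℝ), 1 / 2 < β → β < 1 →
    (∀ β' : ℝ, β' < β → {i : ι | 1 / 2 < (ρ i).re ∧ (ρ i).re ≤ β'}.Finite) →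
    (∀ σ₀ : ℝ, 1 / 2 < σ₀ → σ₀ < β → ∃ C T₀ : ℝ, ∀ T : ℝ, T₀ ≤ T →
        ({i : ι | σ₀ ≤ (ρ i).re ∧ |(ρ i).im| ≤ T}.ncard : ℝ) ≤ C * T ^ (2 * (1 - σ₀)) * Real.log T ^ 2) →
    (∃ c T₀ : ℝ, 0 < c ∧ ∀ T : ℝ, T₀ ≤ T →
        c * T ^ e ≤ ({i : ι | 1 / 2 < (ρ i).re ∧ |(ρ i).im| ≤ T}.ncard : ℝ)) →
    e ≤ 2 * (1 - β) := by
  intro ι ρ β e hβ _hβ1 hdisc hup hlow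
  by_contra hcon
  have he : 2 * (1 - β) < e := lt_of_not_ge hcon
  -- choose `σ₀ ∈ (1/2, β)` with `2(1 - σ₀) < e`
  set a : ℝ := max (1 / 2) (1 - e / 2) with ha
  have haβ : a < β := max_lt hβ (by linarith)
  set σ₀ : ℝ := (a + β) / 2 with hσ₀
  have hσ₀a : a < σ₀ := by rw [hσ₀]; linarith
  have hσ₀β : σ₀ < β := by rw [hσ₀]; linarith
  have hσ₀half : 1 / 2 < σ₀ := lt_of_le_of_lt (le_max_left _ _) hσ₀a
  have hσ₀e : 2 * (1 - σ₀) < e := by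
    have : 1 - e / 2 < σ₀ := lt_of_le_of_lt (le_max_right _ _) hσ₀a
    linarith
  have he0 : 0 < e := by linarith
  obtain ⟨C, T₁, hC⟩ := hup σ₀ hσ₀half hσ₀β
  obtain ⟨c, T₂, hc, hcT⟩ := hlow
  -- the finitely many tower zeros with abscissa in `(1/2, σ₀]`
  set F : Set ι := {i : ι | 1 / 2 < (ρ i).re ∧ (ρ i).re ≤ σ₀} with hF
  have hFfin : F.Finite := hdisc σ₀ hσ₀β
  set N₀ : ℝ := (F.ncard : ℝ) with hN₀
  -- the count inequality for large `T`
  have hineq : ∀ T : ℝ, max (max T₁ T₂) 1 ≤ T →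
      c * T ^ e ≤ C * T ^ (2 * (1 - σ₀)) * Real.log T ^ 2 + N₀ := by
    intro T hT
    have hT₁ : T₁ ≤ T := le_trans (le_trans (le_max_left _ _) (le_max_left _ _)) hT
    have hT₂ : T₂ ≤ T := le_trans (le_trans (le_max_right _ _) (le_max_left _ _)) hT
    have hT0 : 0 < T := lt_of_lt_of_le one_pos (le_trans (le_max_right _ _) hT)
    set A : Set ι := {i : ι | 1 / 2 < (ρ i).re ∧ |(ρ i).im| ≤ T} with hA
    set B : Set ι := {i : ι | σ₀ ≤ (ρ i).re ∧ |(ρ i).im| ≤ T} with hB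
    have hlowT := hcT T hT₂
    have hBA : B ⊆ A := fun i hi ↦ ⟨lt_of_lt_of_le hσ₀half hi.1, hi.2⟩
    have hAsub : A ⊆ B ∪ F := by
      intro i hi
      by_cases h : σ₀ ≤ (ρ i).re
      · exact Or.inl ⟨h, hi.2⟩
      · exact Or.inr ⟨hi.1, (not_le.1 h).le⟩
    by_cases hBfin : B.Finite
    · have h1 : (A.ncard : ℝ) ≤ (B.ncard : ℝ) + N₀ := by
        have := (Set.ncard_le_ncard hAsub (hBfin.union hFfin)).trans (Set.ncard_union_le B F)
        rw [hN₀]; exact_mod_cast this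
      linarith [hC T hT₁]
    · exfalso
      have hAinf : A.Infinite := fun hAfin ↦ hBfin (hAfin.subset hBA)
      rw [hAinf.ncard, Nat.cast_zero] at hlowT
      have : 0 < c * T ^ e := mul_pos hc (Real.rpow_pos_of_pos hT0 e)
      linarith
  -- the right-hand side, divided by `T^e`, tends to `0`
  have hδ : 0 < e - 2 * (1 - σ₀) := by linarith
  have hlim1 : Tendsto (fun T : ℝ ↦ Real.log T ^ 2 / T ^ (e - 2 * (1 - σ₀))) atTop (𝓝 0) := by
    have h := (isLittleO_log_rpow_rpow_atTop (2 : ℝ) hδ).tendsto_div_nhds_zero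
    refine h.congr' (Eventually.of_forall fun T ↦ ?_)
    simp only [Real.rpow_two]
  have hlim2 : Tendsto (fun T : ℝ ↦ T ^ (-e)) atTop (𝓝 0) := tendsto_rpow_neg_atTop he0
  have hlim : Tendsto (fun T : ℝ ↦ C * (Real.log T ^ 2 / T ^ (e - 2 * (1 - σ₀))) + N₀ * T ^ (-e))
      atTop (𝓝 0) := by
    have := (hlim1.const_mul C).add (hlim2.const_mul N₀)
    simpa using this
  have hev : ∀ᶠ T : ℝ in atTop,
      C * (Real.log T ^ 2 / T ^ (e - 2 * (1 - σ₀))) + N₀ * T ^ (-e) < c :=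
    hlim.eventually (gt_mem_nhds hc)
  obtain ⟨T, hT1, hT2⟩ := (hev.and (eventually_ge_atTop (max (max T₁ T₂) 1))).exists
  have hT0 : 0 < T := lt_of_lt_of_le one_pos (le_trans (le_max_right _ _) hT2)
  have hTe : 0 < T ^ e := Real.rpow_pos_of_pos hT0 e
  have h := hineq T hT2
  -- divide the count inequality by `T^e`
  have hdiv : c ≤ C * (Real.log T ^ 2 / T ^ (e - 2 * (1 - σ₀))) + N₀ * T ^ (-e) := by
    have e1 : T ^ (e - 2 * (1 - σ₀)) = T ^ e / T ^ (2 * (1 - σ₀)) :=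
      Real.rpow_sub hT0 _ _
    have e2 : T ^ (-e) = (T ^ e)⁻¹ := Real.rpow_neg hT0.le e
    have hTa : 0 < T ^ (2 * (1 - σ₀)) := Real.rpow_pos_of_pos hT0 _
    rw [e1, e2, div_div_eq_mul_div]
    rw [← sub_nonneg]
    have : C * (Real.log T ^ 2 * T ^ (2 * (1 - σ₀)) / T ^ e) + N₀ * (T ^ e)⁻¹ - c =
        (C * T ^ (2 * (1 - σ₀)) * Real.log T ^ 2 + N₀ - c * T ^ e) / T ^ e := by
      field_simp
    rw [this]
    exact div_nonneg (by linarith) hTe.le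
  linarith

end Summit.RiemannHypothesis.RiemannHypothesis.Theorems.DensityLadderSeparatedTowerExponent

end
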